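import Mathlib.Tactic.DeriveFintype
import Literature.Computability.Complexity.PolyTimeCountable
import Literature.Computability.Complexity.SymbolPrograms
import HarnessLib

/-!
# Every `TM2` machine is a binary stack register program, with linear overhead

Literature / complexity toolkit (the normal form behind the universal simulation of the
nondeterministic time hierarchy theorem, `NTIMEHierarchyDiagonal.lean`). The converse of
`SymbolPrograms.lean` / `StackMachinesTM2.lean` ("a stack register program is a `TM2`
machine"): every bundled machine `M : Turing.TM2ComputableAux Bool Bool` — arbitrarily many
stacks with arbitrary alphabets, statement trees acting on an internal state — is simulated by a
STRUCTURED binary stack program (`ACom Bool (TM2Flat.Reg nK)` of `SymbolPrograms.lean`: one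
binary register per stack, a control register and a scratch register), hence by a flat binary
program (`AProg Bool _`: `push`/`pop`/`goto`), within `e · (m + |l| + |l'|) + e` instructions
for a run of `m` steps from the input `l` to the output `l'` (**`TM2Flat.exists_runs_of_outputsWithin`**,
**`TM2Flat.exists_aprog_of_outputsWithin`**, **`TM2Flat.exists_aprogFin_of_outputsWithin`**).

Construction. First standardise `M` (`TM2Std.stdCode`, `PolyTimeCountable.lean`: stacks
`Fin nK`, shared alphabet `Fin (N+1)`, labels `Fin nΛ`, states `Fin nσ`, step for step). Then:

* symbols are written in unary blocks `1ᵃ 0` (`TM2Flat.block`), a stack as the concatenation of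
  the blocks of its symbols (`TM2Flat.blocks`); reading a symbol is a chain of pops
  (`TM2Flat.chain`, at most `N + 1` of them), writing one is `a + 1` pushes;
* the internal state is folded into the program text: the statement tree `q` of a label in
  state `s` becomes the structured program `TM2Flat.trStmt q s` (push ↦ push the block of
  `f s`; peek/pop ↦ read a block and continue with the translation in the new state, one
  continuation per symbol; load/branch ↦ static; `goto f` ↦ write the block of the control
  code of `(f s, s)` on the control register; `halt` ↦ write nothing), simulating
  `TM2.stepAux` exactly (`TM2Flat.runs_trStmt`);
* the machine is the loop `while ctrl ≠ ε: decode the control code (l, s); run trStmt (prog l) s`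
  (`TM2Flat.mainLoop`, `TM2Flat.runs_mainLoop`: `n` machine steps cost `≤ n · stepCost + 1`);
* a prelude recodes the Boolean input word into blocks of the codes of the input symbols and a
  postlude decodes the output blocks into Booleans (`TM2Flat.prelude`, `TM2Flat.postlude`),
  both linear.

So a time bound proved for `M` in Mathlib's model transfers, up to the constant `e`, to a
program in the simplest flat model, the one a universal machine can interpret cheaply
(Arora–Barak 2009, §1.3, Claim 1.5: linear-overhead recoding of an arbitrary alphabet in
binary; §1.4: folding the finite control into the program text).

**Position in the tree.** `FlatPrograms.lean` / `FlatRuns.lean` already compile standard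
machines into a flat normal form with linear overhead — `FlatProg.compile`, programs over
`ℕ`-numbered stacks of `ℕ`-SYMBOLS with table-driven `pop k t` (one target per symbol number),
with the two-way interface `FlatProg.flat_complete` / `FlatProg.flat_sound`, consumed by the
polynomial-time universal STEP function of `UniversalStep.lean` / `ClockedUniversalAcceptance.lean`.
The present file is NOT that normal form and `TM2Flat.binProg` is not `FlatProg.compile`: its
target is the BINARY register model `AProg Bool` of `SymbolPrograms.lean` (symbols recoded in
unary blocks, so that a fixed binary machine can hold a simulated stack on one of its own
stacks verbatim), with the Boolean input/output words UNCODED on the input/output registers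
(prelude/postlude), which is the form the linear-time multi-pass transcript check of the
nondeterministic time hierarchy theorem interprets (`FlatTranscripts.lean`). Only the
completeness direction (`OutputsWithin → Runs`) is proved here; the diagonalizer applies it to
TOTAL machines (every input halts with a known output), for which completeness together with
determinism of `AProg.step` already identifies every halting flat run, so no soundness converse
in the style of `FlatProg.flat_sound` is needed downstream.

## References

* S. Arora, B. Barak, *Computational Complexity: A Modern Approach*, CUP 2009, §1.3–1.4
  (robustness of the model; machines as strings), Claim 1.6.
* M. L. Minsky, *Computation: Finite and Infinite Machines*, Prentice-Hall 1967, §14.1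
  (push-down registers over `{0,1}`).
* T. Nipkow, G. Klein, *Concrete Semantics with Isabelle/HOL*, Springer 2014, Ch. 7–8.
-/

namespace Literature.Computability.Complexity

open Turing Function _root_.Computability

namespace TM2Flat

open ACom

/-! ### Registers, stores, unary blocks -/

/-- Registers of the flat program of a machine with `nK` stacks: one per stack, the control
register and a scratch register. [folklore] -/
inductive Reg (nK : ℕ) : Type
  | stk (k : Fin nK)
  | ctrl
  | tmp
  deriving DecidableEq, Fintype

/-- Stores. [folklore] -/
abbrev Store (nK : ℕ) : Type := AStore Bool (Reg nK)

/-- Programs. [folklore] -/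
abbrev Prog (nK : ℕ) : Type := ACom Bool (Reg nK)

/-- The unary block of `a`: `1ᵃ 0`. [folklore] -/
def block (a : ℕ) : List Bool := List.replicate a true ++ [false]

/-- A stack of symbol numbers as the concatenation of their blocks (top first). [folklore] -/
def blocks (L : List ℕ) : List Bool := L.flatMap block

/-- `block a = 1ᵃ ++ 0 :: []`. [folklore] -/
theorem block_eq (a : ℕ) : block a = List.replicate a true ++ false :: [] := rfl

/-- Length of a block. [folklore] -/
@[simp] theorem length_block (a : ℕ) : (block a).length = a + 1 := by simp [block]

/-- `blocks (a :: L) = 1ᵃ ++ 0 :: blocks L`. [folklore] -/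
theorem blocks_cons (a : ℕ) (L : List ℕ) :
    blocks (a :: L) = List.replicate a true ++ false :: blocks L := by
  simp [blocks, block]

/-- Length of `blocks L`: at most `(B + 1) |L|` when all entries are `≤ B`. [folklore] -/
theorem length_blocks_le {B : ℕ} : ∀ {L : List ℕ}, (∀ a ∈ L, a ≤ B) →
    (blocks L).length ≤ (B + 1) * L.length
  | [], _ => by simp [blocks]
  | a :: L, h => by
    have ha := h a (by simp)
    have ih := length_blocks_le (L := L) fun b hb => h b (by simp [hb])
    rw [blocks_cons, List.length_append, List.length_cons, List.length_replicate,
      List.length_cons]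
    nlinarith

/-- The store with stacks `S` (symbol numbers, block-coded), control word `ctl` and scratch
`tmp`. [folklore] -/
def enc {nK : ℕ} (S : Fin nK → List ℕ) (ctl tmp : List Bool) : Store nK
  | .stk k => blocks (S k)
  | .ctrl => ctl
  | .tmp => tmp

section EncLemmas

variable {nK : ℕ} (S : Fin nK → List ℕ) (ctl tmp v : List Bool)

/-- Read-out of a stack register. [folklore] -/
@[simp] theorem enc_stk (k : Fin nK) : enc S ctl tmp (.stk k) = blocks (S k) := rfl
/-- Read-out of the control register. [folklore] -/
@[simp] theorem enc_ctrl : enc S ctl tmp .ctrl = ctl := rfl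
/-- Read-out of the scratch register. [folklore] -/
@[simp] theorem enc_tmp : enc S ctl tmp .tmp = tmp := rfl

/-- Update of the control register. [folklore] -/
@[simp] theorem update_enc_ctrl : update (enc S ctl tmp) .ctrl v = enc S v tmp := by
  funext r; cases r <;> simp [enc]

/-- Update of the scratch register. [folklore] -/
@[simp] theorem update_enc_tmp : update (enc S ctl tmp) .tmp v = enc S ctl v := by
  funext r; cases r <;> simp [enc]

/-- Update of a stack register by a coded stack. [folklore] -/
theorem update_enc_stk (k : Fin nK) (L : List ℕ) :
    update (enc S ctl tmp) (.stk k) (blocks L) = enc (update S k L) ctl tmp := by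
  funext r
  cases r with
  | stk k' =>
    by_cases h : k' = k
    · subst h; simp
    · rw [update_of_ne (by simpa using h)]; simp [update_of_ne h]
  | ctrl => simp
  | tmp => simp

end EncLemmas

/-! ### Writing and reading blocks -/

variable {nK : ℕ}

/-- `pushOnes r a`: push `a` tokens `1` on `r`. [folklore] -/
def pushOnes (r : Reg nK) : ℕ → Prog nK
  | 0 => skip
  | a + 1 => push r true ;; pushOnes r a

/-- Effect and cost of `pushOnes`. [folklore] -/
theorem runs_pushOnes (r : Reg nK) : ∀ (a : ℕ) (R : Store nK),
    Runs (pushOnes r a) R (update R r (List.replicate a true ++ R r)) a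
  | 0, R => by simpa [pushOnes] using Runs.skip R
  | a + 1, R => by
    have h := (Runs.push r true R).seq (runs_pushOnes r a (update R r (true :: R r)))
    refine h.of_eq ?_ (by omega)
    simp [List.replicate_succ']

/-- `pushBlock r a`: write the block of `a` on `r` (terminator first). [folklore] -/
def pushBlock (r : Reg nK) (a : ℕ) : Prog nK := push r false ;; pushOnes r a

/-- Effect and cost of `pushBlock`: `r := block a ++ r` in `a + 1` steps. [folklore] -/
theorem runs_pushBlock (r : Reg nK) (a : ℕ) (R : Store nK) :
    Runs (pushBlock r a) R (update R r (block a ++ R r)) (a + 1) := by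
  have h := (Runs.push r false R).seq (runs_pushOnes r a (update R r (false :: R r)))
  refine h.of_eq ?_ (by omega)
  simp [block]

/-- `pushRevBlock r a`: write the REVERSED block of `a` on `r` (tokens first). [folklore] -/
def pushRevBlock (r : Reg nK) (a : ℕ) : Prog nK := pushOnes r a ;; push r false

/-- Effect and cost of `pushRevBlock`: `r := (block a).reverse ++ r` in `a + 1` steps.
[folklore] -/
theorem runs_pushRevBlock (r : Reg nK) (a : ℕ) (R : Store nK) :
    Runs (pushRevBlock r a) R (update R r ((block a).reverse ++ R r)) (a + 1) := by
  have h := (runs_pushOnes r a R).seq (Runs.push r false (update R r (List.replicate a true ++ R r)))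
  refine h.of_eq ?_ (by omega)
  simp [block]

/-- `chain r cont i fuel`: read the rest of a block from `r`, `i` tokens having been read
already, with at most `fuel` further pops; continue with `cont (some a)` for the symbol number
`a`, or with `cont none` if `r` is empty. [folklore] -/
def chain (r : Reg nK) (cont : Option ℕ → Prog nK) : ℕ → ℕ → Prog nK
  | i, 0 => cont (some i)
  | i, fuel + 1 => pop r fun o => match o with
    | some true => chain r cont (i + 1) fuel
    | some false => cont (some i)
    | none => cont none

/-- Reading a block: if `r = 1ʲ 0 rest` with `j < fuel`, the chain pops the block
(`2 (j + 1)` steps) and continues with `cont (some (j + i))` on `rest`. [folklore] -/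
theorem runs_chain_block (r : Reg nK) (cont : Option ℕ → Prog nK) {R' : Store nK} {B : ℕ} :
    ∀ (j i fuel : ℕ) (R : Store nK) (rest : List Bool),
      R r = List.replicate j true ++ false :: rest → j < fuel →
      Runs (cont (some (j + i))) (update R r rest) R' B →
      Runs (chain r cont i fuel) R R' (B + 2 * (j + 1))
  | 0, i, fuel + 1, R, rest, hr, _, h => by
    rw [chain]
    exact (Runs.pop_cons (f := fun o => match o with
      | some true => chain r cont (i + 1) fuel
      | some false => cont (some i)
      | none => cont none) (by simpa using hr) (by simpa using h)).mono (by omega)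
  | j + 1, i, fuel + 1, R, rest, hr, hj, h => by
    rw [chain]
    have e : j + 1 + i = j + (i + 1) := by omega
    rw [e] at h
    have ih := runs_chain_block r cont j (i + 1) fuel (update R r (List.replicate j true ++ false :: rest))
      rest (by simp) (by omega) (by simpa using h)
    refine (Runs.pop_cons (f := fun o => match o with
      | some true => chain r cont (i + 1) fuel
      | some false => cont (some i)
      | none => cont none) (a := true) (w := List.replicate j true ++ false :: rest)
      (by rw [hr]; rfl) ih).mono (by omega)

/-- Reading from an empty register: `cont none` after one pop (`2` steps). [folklore] -/
theorem runs_chain_nil (r : Reg nK) (cont : Option ℕ → Prog nK) {R R' : Store nK} {B : ℕ}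
    {i fuel : ℕ} (hr : R r = []) (hf : 0 < fuel) (h : Runs (cont none) R R' B) :
    Runs (chain r cont i fuel) R R' (B + 2) := by
  obtain ⟨fuel, rfl⟩ : ∃ f, fuel = f + 1 := ⟨fuel - 1, by omega⟩
  rw [chain]
  exact Runs.pop_nil hr h

/-! ### Translating the statements of a standard machine -/

section Std

variable (c : TM2Std.SCode)

/-- Stack assignments of the standard machine `c`. [folklore] -/
abbrev Stk : Type := ∀ _ : Fin c.nK, List (Fin (c.N + 1))

/-- Configurations of the standard machine `c`. [folklore] -/
abbrev Cfg : Type := TM2.Cfg (fun _ : Fin c.nK => Fin (c.N + 1)) (Fin c.nΛ) (Fin c.nσ)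

/-- The control code of the pair (label, state). [folklore] -/
def ctrlVal (l : Fin c.nΛ) (s : Fin c.nσ) : ℕ := (finProdFinEquiv (l, s)).val

/-- Control codes are `< nΛ · nσ`. [folklore] -/
theorem ctrlVal_lt (l : Fin c.nΛ) (s : Fin c.nσ) : ctrlVal c l s < c.nΛ * c.nσ :=
  (finProdFinEquiv (l, s)).isLt

/-- Decoding a control code. [folklore] -/
theorem symm_ctrlVal (l : Fin c.nΛ) (s : Fin c.nσ) :
    finProdFinEquiv.symm ⟨ctrlVal c l s, ctrlVal_lt c l s⟩ = (l, s) := by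
  have e : (⟨ctrlVal c l s, ctrlVal_lt c l s⟩ : Fin (c.nΛ * c.nσ)) = finProdFinEquiv (l, s) :=
    Fin.ext rfl
  rw [e, Equiv.symm_apply_apply]

/-- The control word of the next step: the block of the control code, or nothing when halted.
[folklore] -/
def nextCtrl : Option (Fin c.nΛ) → Fin c.nσ → List Bool
  | some l, s => block (ctrlVal c l s)
  | none, _ => []

/-- The store of a stack assignment of the standard machine. [folklore] -/
def encS (S : Stk c) (ctl tmp : List Bool) : Store c.nK :=
  enc (fun k => (S k).map Fin.val) ctl tmp

/-- The store of a configuration of the standard machine (scratch empty). [folklore] -/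
def encCfg (C : Cfg c) : Store c.nK := encS c C.stk (nextCtrl c C.l C.var) []

/-- Read-out of a stack register. [folklore] -/
@[simp] theorem encS_stk (S : Stk c) (ctl tmp : List Bool) (k : Fin c.nK) :
    encS c S ctl tmp (.stk k) = blocks ((S k).map Fin.val) := rfl

/-- Read-out of the control register. [folklore] -/
@[simp] theorem encS_ctrl (S : Stk c) (ctl tmp : List Bool) : encS c S ctl tmp .ctrl = ctl := rfl

/-- Read-out of the scratch register. [folklore] -/
@[simp] theorem encS_tmp (S : Stk c) (ctl tmp : List Bool) : encS c S ctl tmp .tmp = tmp := rfl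

/-- Update of the control register. [folklore] -/
@[simp] theorem update_encS_ctrl (S : Stk c) (ctl tmp v : List Bool) :
    update (encS c S ctl tmp) .ctrl v = encS c S v tmp :=
  update_enc_ctrl _ _ _ _

/-- Update of the scratch register. [folklore] -/
@[simp] theorem update_encS_tmp (S : Stk c) (ctl tmp v : List Bool) :
    update (encS c S ctl tmp) .tmp v = encS c S ctl v :=
  update_enc_tmp _ _ _ _

/-- Update of a stack register by a coded stack. [folklore] -/
theorem update_encS_stk (S : Stk c) (ctl tmp : List Bool) (k : Fin c.nK) (L : List (Fin (c.N + 1))) :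
    update (encS c S ctl tmp) (.stk k) (blocks (L.map Fin.val)) = encS c (update S k L) ctl tmp := by
  rw [encS, update_enc_stk]
  unfold encS
  congr 1
  funext k'
  by_cases h : k' = k
  · subst h; simp
  · simp [update_of_ne h]

/-- **Translation of a statement tree in a given state** into a structured binary stack
program: `push` writes the block of the pushed symbol; `peek`/`pop` read a block and continue
with the translation in the new state (restoring the block for `peek`); `load`/`branch` are
resolved statically; `goto f` writes the control code of `(f s, s)`; `halt` writes nothing.
[cite: AroraBarak2009, §1.4] -/
def trStmt : TM2Std.SStmt c.nK c.N c.nΛ c.nσ → Fin c.nσ → Prog c.nK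
  | .push k f q, s => pushBlock (.stk k) (f s).val ;; trStmt q s
  | .peek k f q, s => chain (.stk k) (fun o => match o with
      | none => trStmt q (f s none)
      | some v => if h : v < c.N + 1 then pushBlock (.stk k) v ;; trStmt q (f s (some ⟨v, h⟩))
          else skip) 0 (c.N + 1)
  | .pop k f q, s => chain (.stk k) (fun o => match o with
      | none => trStmt q (f s none)
      | some v => if h : v < c.N + 1 then trStmt q (f s (some ⟨v, h⟩)) else skip) 0 (c.N + 1)
  | .load f q, s => trStmt q (f s)
  | .branch p q₁ q₂, s => bif p s then trStmt q₁ s else trStmt q₂ s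
  | .goto f, s => pushBlock .ctrl (ctrlVal c (f s) s)
  | .halt, _ => skip

/-- A cost bound for the translation of a statement (uniform in the state). [folklore] -/
def cost : TM2Std.SStmt c.nK c.N c.nΛ c.nσ → ℕ
  | .push _ _ q => (c.N + 1) + cost q
  | .peek _ _ q => 3 * (c.N + 1) + cost q
  | .pop _ _ q => 2 * (c.N + 1) + cost q
  | .load _ q => cost q
  | .branch _ q₁ q₂ => max (cost q₁) (cost q₂)
  | .goto _ => c.nΛ * c.nσ
  | .halt => 0

/-- **The translation simulates `TM2.stepAux`**: from the coded stacks (control and scratch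
empty), `trStmt q s` ends with the coded new stacks and the control word of the new label and
state, within `cost q` steps. [cite: AroraBarak2009, §1.4] -/
theorem runs_trStmt : ∀ (q : TM2Std.SStmt c.nK c.N c.nΛ c.nσ) (s : Fin c.nσ) (S : Stk c),
    Runs (trStmt c q s) (encS c S [] [])
      (encS c (TM2.stepAux q.toStmt s S).stk
        (nextCtrl c (TM2.stepAux q.toStmt s S).l (TM2.stepAux q.toStmt s S).var) [])
      (cost c q) := by
  intro q
  induction q with
  | push k f q ih =>
    intro s S
    simp only [TM2Std.SStmt.toStmt, TM2.stepAux, trStmt, cost]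
    have h1 := runs_pushBlock (Reg.stk k) (f s).val (encS c S [] [])
    have e1 : update (encS c S [] []) (.stk k) (block (f s).val ++ encS c S [] [] (.stk k)) =
        encS c (update S k (f s :: S k)) [] [] := by
      rw [← update_encS_stk]; simp [blocks, List.flatMap_cons]
    rw [e1] at h1
    exact (h1.seq (ih s _)).mono (by have := (f s).isLt; omega)
  | peek k f q ih =>
    intro s S
    simp only [TM2Std.SStmt.toStmt, TM2.stepAux, trStmt, cost]
    cases hk : S k with
    | nil =>
      refine (runs_chain_nil (Reg.stk k) _ (B := cost c q) (by simp [hk, blocks]) (Nat.succ_pos _) ?_).mono ?_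
      · exact ih (f s none) S
      · omega
    | cons a L =>
      have hr : encS c S [] [] (.stk k) = List.replicate a.val true ++ false :: blocks (L.map Fin.val) := by
        simp [hk, blocks_cons]
      refine (runs_chain_block (Reg.stk k) _ (B := cost c q + (a.val + 1)) a.val 0 (c.N + 1)
        (encS c S [] []) (blocks (L.map Fin.val)) hr a.isLt ?_).mono ?_
      · show Runs (if h : a.val + 0 < c.N + 1 then _ else _) _ _ (cost c q + (a.val + 1))
        rw [dif_pos (by simpa using a.isLt)]
        rw [update_encS_stk]
        have h1 := runs_pushBlock (Reg.stk k) (a.val + 0) (encS c (update S k L) [] [])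
        have e1 : update (encS c (update S k L) [] []) (.stk k)
            (block (a.val + 0) ++ encS c (update S k L) [] [] (.stk k)) = encS c S [] [] := by
          rw [encS_stk, update_self, show block (a.val + 0) ++ blocks (L.map Fin.val) =
            blocks ((a :: L).map Fin.val) by simp [blocks_cons, block], update_encS_stk,
            update_idem, ← hk, update_eq_self]
        rw [e1] at h1
        have h2 := ih (f s (some a)) S
        have ea : (⟨a.val + 0, by simpa using a.isLt⟩ : Fin (c.N + 1)) = a := Fin.ext (by simp)
        rw [ea]
        simpa [Nat.add_comm] using h1.seq h2
      · have := a.isLt; omega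
  | pop k f q ih =>
    intro s S
    simp only [TM2Std.SStmt.toStmt, TM2.stepAux, trStmt, cost]
    cases hk : S k with
    | nil =>
      have e : update S k ([] : List (Fin (c.N + 1))) = S := by
        rw [← hk, update_eq_self]
      refine (runs_chain_nil (Reg.stk k) _ (B := cost c q) (by simp [hk, blocks]) (Nat.succ_pos _) ?_).mono ?_
      · simpa [e] using ih (f s none) S
      · omega
    | cons a L =>
      have hr : encS c S [] [] (.stk k) = List.replicate a.val true ++ false :: blocks (L.map Fin.val) := by
        simp [hk, blocks_cons]
      refine (runs_chain_block (Reg.stk k) _ (B := cost c q) a.val 0 (c.N + 1) (encS c S [] [])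
        (blocks (L.map Fin.val)) hr a.isLt ?_).mono ?_
      · show Runs (if h : a.val + 0 < c.N + 1 then _ else _) _ _ (cost c q)
        rw [dif_pos (by simpa using a.isLt), update_encS_stk]
        have ea : (⟨a.val + 0, by simpa using a.isLt⟩ : Fin (c.N + 1)) = a := Fin.ext (by simp)
        rw [ea]
        simpa using ih (f s (some a)) (update S k L)
      · have := a.isLt; omega
  | load f q ih =>
    intro s S
    simp only [TM2Std.SStmt.toStmt, TM2.stepAux, trStmt, cost]
    exact ih (f s) S
  | branch p q₁ q₂ ih₁ ih₂ =>
    intro s S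
    simp only [TM2Std.SStmt.toStmt, TM2.stepAux, trStmt, cost]
    cases p s
    · simpa using (ih₂ s S).mono (le_max_right _ _)
    · simpa using (ih₁ s S).mono (le_max_left _ _)
  | goto f =>
    intro s S
    simp only [TM2Std.SStmt.toStmt, TM2.stepAux, trStmt, cost]
    have h1 := runs_pushBlock Reg.ctrl (ctrlVal c (f s) s) (encS c S [] [])
    simp only [encS_ctrl, List.append_nil, update_encS_ctrl] at h1
    exact h1.mono (ctrlVal_lt c (f s) s)
  | halt =>
    intro s S
    simp only [TM2Std.SStmt.toStmt, TM2.stepAux, trStmt, cost]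
    exact Runs.skip _

/-! ### The main loop: decode the control code, run the statement -/

/-- `dispatch v`: the translation of the statement of label `l` in state `s`, for the control
code `v` of `(l, s)` (nothing for an invalid code). [folklore] -/
def dispatch (v : ℕ) : Prog c.nK :=
  if h : v < c.nΛ * c.nσ then
    trStmt c (c.prog (finProdFinEquiv.symm ⟨v, h⟩).1) (finProdFinEquiv.symm ⟨v, h⟩).2
  else skip

/-- Dispatching on a genuine control code. [folklore] -/
theorem dispatch_ctrlVal (l : Fin c.nΛ) (s : Fin c.nσ) :
    dispatch c (ctrlVal c l s) = trStmt c (c.prog l) s := by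
  rw [dispatch, dif_pos (ctrlVal_lt c l s), symm_ctrlVal]

/-- The loop body: the first symbol `b` of the control block has been popped by the loop; read
the rest of the block and dispatch. [folklore] -/
def body : Bool → Prog c.nK
  | false => dispatch c 0
  | true => chain .ctrl (fun o => match o with
      | some v => dispatch c v
      | none => skip) 1 (c.nΛ * c.nσ)

/-- **The main loop**: while the control register is nonempty, decode `(l, s)` and run the
translation of statement `l` in state `s`. [cite: AroraBarak2009, §1.4] -/
def mainLoop : Prog c.nK := loop .ctrl (body c)

/-- The largest statement cost of the program. [folklore] -/
noncomputable def maxCost : ℕ := Finset.univ.sup fun l : Fin c.nΛ => cost c (c.prog l)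

/-- Every statement cost is below `maxCost`. [folklore] -/
theorem cost_le_maxCost (l : Fin c.nΛ) : cost c (c.prog l) ≤ maxCost c :=
  Finset.le_sup (f := fun l : Fin c.nΛ => cost c (c.prog l)) (Finset.mem_univ l)

/-- The cost of one simulated machine step (loop overhead, decoding, statement).
[folklore] -/
noncomputable def stepCost : ℕ := 2 * (c.nΛ * c.nσ) + 2 + maxCost c

/-- A block is a nonempty word. [folklore] -/
theorem block_ne_nil (a : ℕ) : block a ≠ [] := by simp [block]

/-- **One machine step**: from the coded stacks with the tail of the control block of `(l, s)`
on the control register, the body ends in the coded successor configuration.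
[cite: AroraBarak2009, §1.4] -/
theorem runs_body (l : Fin c.nΛ) (s : Fin c.nσ) (S : Stk c) {b : Bool} {rest : List Bool}
    (hb : block (ctrlVal c l s) = b :: rest) :
    Runs (body c b) (encS c S rest [])
      (encCfg c (TM2.stepAux (c.prog l).toStmt s S)) (2 * (c.nΛ * c.nσ) + maxCost c) := by
  have hst := runs_trStmt c (c.prog l) s S
  rw [← dispatch_ctrlVal] at hst
  have hv := ctrlVal_lt c l s
  cases hv0 : ctrlVal c l s with
  | zero =>
    rw [hv0] at hb hst
    obtain ⟨rfl, rfl⟩ : b = false ∧ rest = [] := by simpa [block] using hb.symm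
    exact hst.mono (by have := cost_le_maxCost c l; omega)
  | succ j =>
    rw [hv0] at hb hst hv
    have hb' : b = true ∧ rest = List.replicate j true ++ false :: [] := by
      simp only [block, List.replicate_succ, List.cons_append, List.cons.injEq] at hb
      exact ⟨hb.1.symm, hb.2.symm⟩
    obtain ⟨rfl, rfl⟩ := hb'
    refine (runs_chain_block Reg.ctrl _ (B := cost c (c.prog l)) j 1 (c.nΛ * c.nσ)
      (encS c S (List.replicate j true ++ [false]) []) [] rfl (by omega) ?_).mono ?_
    · rw [update_encS_ctrl]; exact hst
    · have := cost_le_maxCost c l; omega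

/-- **The main loop simulates the machine**: a run of `n` steps of the standard machine
ending in a halted configuration is a run of the loop within `n · stepCost + 1` steps between
the coded configurations. [cite: AroraBarak2009, §1.4] -/
theorem runs_mainLoop : ∀ (n : ℕ) (C C' : Cfg c),
    (flip bind (TM2.step fun l => (c.prog l).toStmt))^[n] (some C) = some C' → C'.l = none →
    Runs (mainLoop c) (encCfg c C) (encCfg c C') (n * stepCost c + 1)
  | 0, C, C', h, hl => by
    obtain rfl : C = C' := by simpa using h
    obtain ⟨ol, s, S⟩ := C
    cases hl
    simpa [mainLoop, encCfg, nextCtrl] using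
      Runs.loop_nil (body c) (k := Reg.ctrl) (R := encS c S [] []) rfl
  | n + 1, ⟨none, s, S⟩, C', h, hl => by
    rw [TM2Comp.iterate_bind_succ] at h
    have e : TM2.step (fun l => (c.prog l).toStmt) ⟨none, s, S⟩ = none := rfl
    rw [e, TM2Comp.iterate_bind_none] at h
    cases h
  | n + 1, ⟨some l, s, S⟩, C', h, hl => by
    rw [TM2Comp.iterate_bind_succ] at h
    simp only [TM2.step] at h
    have ih := runs_mainLoop n _ C' h hl
    obtain ⟨b, rest, hb⟩ : ∃ b rest, block (ctrlVal c l s) = b :: rest := by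
      cases h' : block (ctrlVal c l s) with
      | nil => exact absurd h' (block_ne_nil _)
      | cons b rest => exact ⟨b, rest, rfl⟩
    have h1 := runs_body c l s S hb
    have hloop := Runs.loop_cons (k := Reg.ctrl) (f := body c)
      (R := encS c S (block (ctrlVal c l s)) []) (a := b) (w := rest) (by simp [hb])
      (by simpa using h1) ih
    refine hloop.of_eq rfl ?_
    simp only [stepCost]
    ring_nf
    omega

end Std

/-! ### Prelude and postlude: Boolean words versus blocks -/

/-- The store with the word `w` on the stack register `k`, scratch `tmp`, everything else empty.
[folklore] -/
def ioStore (k : Fin nK) (w tmp : List Bool) : Store nK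
  | .stk k' => if k' = k then w else []
  | .ctrl => []
  | .tmp => tmp

/-- Read-out of the designated register. [folklore] -/
@[simp] theorem ioStore_self (k : Fin nK) (w tmp : List Bool) : ioStore k w tmp (.stk k) = w := by
  simp [ioStore]

/-- Read-out of the scratch register. [folklore] -/
@[simp] theorem ioStore_tmp (k : Fin nK) (w tmp : List Bool) : ioStore k w tmp .tmp = tmp := rfl

/-- Read-out of the control register. [folklore] -/
@[simp] theorem ioStore_ctrl (k : Fin nK) (w tmp : List Bool) : ioStore k w tmp .ctrl = [] := rfl

/-- Update of the designated register. [folklore] -/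
@[simp] theorem update_ioStore_self (k : Fin nK) (w tmp v : List Bool) :
    update (ioStore k w tmp) (.stk k) v = ioStore k v tmp := by
  funext r; cases r with
  | stk k' => by_cases h : k' = k
              · subst h; simp
              · rw [update_of_ne (by simpa using h)]; simp [ioStore, h]
  | ctrl => simp
  | tmp => simp

/-- Update of the scratch register. [folklore] -/
@[simp] theorem update_ioStore_tmp (k : Fin nK) (w tmp v : List Bool) :
    update (ioStore k w tmp) .tmp v = ioStore k w v := by
  funext r; cases r <;> simp [ioStore]

/-- The initial/final stores of `SymbolPrograms.lean` are `ioStore`s. [folklore] -/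
theorem single_eq_ioStore (k : Fin nK) (w : List Bool) :
    AStore.single (.stk k) w = ioStore k w [] := by
  funext r; cases r with
  | stk k' => by_cases h : k' = k
              · subst h; simp
              · rw [AStore.single_of_ne (by simpa using h)]; simp [ioStore, h]
  | ctrl => rw [AStore.single_of_ne (by simp)]; rfl
  | tmp => rw [AStore.single_of_ne (by simp)]; rfl

/-- An `ioStore` with empty scratch is a coded store. [folklore] -/
theorem ioStore_blocks (k : Fin nK) (L : List ℕ) :
    ioStore k (blocks L) [] = enc (update (fun _ => []) k L) [] [] := by
  funext r; cases r with
  | stk k' => by_cases h : k' = k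
              · subst h; simp
              · simp [ioStore, h, blocks]
  | ctrl => rfl
  | tmp => rfl

/-- `prelude k₀ inCode`: recode the Boolean word on `stk k₀` into the blocks of the code
numbers `inCode b` (through the scratch register, two reversals). [folklore] -/
def prelude (k₀ : Fin nK) (inCode : Bool → ℕ) : Prog nK :=
  loop (.stk k₀) (fun b => pushRevBlock .tmp (inCode b)) ;; pour .tmp (.stk k₀)

/-- Reversing a concatenation of reversed blocks. [folklore] -/
theorem reverse_flatMap_reverse {α β : Type} (g : α → List β) : ∀ l : List α,
    (l.reverse.flatMap fun a => (g a).reverse).reverse = l.flatMap g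
  | [] => rfl
  | a :: l => by
    rw [List.reverse_cons, List.flatMap_append, List.reverse_append, reverse_flatMap_reverse g l]
    simp

/-- Length of the scratch word of the prelude. [folklore] -/
theorem length_flatMap_revBlock_le {B : ℕ} {inCode : Bool → ℕ} (hin : ∀ b, inCode b ≤ B) :
    ∀ l : List Bool, (l.flatMap fun b => (block (inCode b)).reverse).length ≤ (B + 1) * l.length
  | [] => by simp
  | b :: l => by
    have ih := length_flatMap_revBlock_le hin l
    have hb := hin b
    simp only [List.flatMap_cons, List.length_append, List.length_reverse, length_block,
      List.length_cons]
    nlinarith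

/-- **Effect and cost of the prelude**: from the Boolean input `l` on `stk k₀` to the coded
store of the stack assignment `k₀ ↦ l.map inCode`, in `O((B + 1) |l|)` steps when all code
numbers are `≤ B`. [folklore] -/
theorem runs_prelude {B : ℕ} (k₀ : Fin nK) {inCode : Bool → ℕ} (hin : ∀ b, inCode b ≤ B)
    (l : List Bool) :
    Runs (prelude k₀ inCode) (ioStore k₀ l [])
      (enc (update (fun _ => []) k₀ (l.map inCode)) [] [])
      ((B + 3) * l.length + 1 + (3 * ((B + 1) * l.length) + 1)) := by
  unfold prelude
  have h1 := runs_loop_inv (k := Reg.stk k₀) (f := fun b => pushRevBlock .tmp (inCode b))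
    (fun done rest => ioStore k₀ rest (done.flatMap fun b => (block (inCode b)).reverse))
    (fun _ _ => True) (B + 1)
    (fun _ _ _ => by simp)
    (fun done a rest _ => ⟨trivial, by
      have h := runs_pushRevBlock Reg.tmp (inCode a)
        (update (ioStore k₀ (a :: rest) (done.flatMap fun b => (block (inCode b)).reverse))
          (Reg.stk k₀) rest)
      refine h.of_eq ?_ (by have := hin a; omega)
      simp [List.flatMap_cons]⟩)
    l [] trivial
  simp only [List.flatMap_nil, List.append_nil] at h1
  have h2 := runs_pour (Γ := Bool) (a := Reg.tmp) (b := Reg.stk k₀) (by simp)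
    (ioStore k₀ [] (l.reverse.flatMap fun b => (block (inCode b)).reverse))
  simp only [ioStore_tmp, ioStore_self, List.append_nil, update_ioStore_tmp,
    update_ioStore_self, reverse_flatMap_reverse] at h2
  have hlen := length_flatMap_revBlock_le hin l.reverse
  rw [List.length_reverse] at hlen
  have e : (B + 1 + 2) * l.length = (B + 3) * l.length := by ring
  refine (h1.seq h2).of_eq ?_ (by omega)
  rw [show (l.flatMap fun b => block (inCode b)) = blocks (l.map inCode) by
    simp [blocks, List.flatMap_map], ioStore_blocks]

/-- The loop body of the postlude: decode one block of `stk k₁` (whose first symbol `b` the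
loop has popped) and push the corresponding Boolean on the scratch register. [folklore] -/
def postBody (N : ℕ) (k₁ : Fin nK) (outBit : ℕ → Bool) : Bool → Prog nK
  | false => push .tmp (outBit 0)
  | true => chain (.stk k₁) (fun o => match o with
      | some v => push .tmp (outBit v)
      | none => skip) 1 (N + 1)

/-- `postlude N k₁ outBit`: decode the blocks on `stk k₁` (symbol numbers `≤ N`) into the
Booleans `outBit a`, in order (through the scratch register). [folklore] -/
def postlude (N : ℕ) (k₁ : Fin nK) (outBit : ℕ → Bool) : Prog nK :=
  loop (.stk k₁) (postBody N k₁ outBit) ;; pour .tmp (.stk k₁)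

/-- Effect and cost of the decoding loop of the postlude. [folklore] -/
theorem runs_postLoop {N : ℕ} (k₁ : Fin nK) (outBit : ℕ → Bool) : ∀ (L : List ℕ),
    (∀ a ∈ L, a ≤ N) → ∀ tmp : List Bool,
    Runs (loop (.stk k₁) (postBody N k₁ outBit)) (ioStore k₁ (blocks L) tmp)
      (ioStore k₁ [] ((L.map outBit).reverse ++ tmp)) ((2 * N + 5) * L.length + 1)
  | [], _, tmp => by
    simpa [blocks] using Runs.loop_nil (postBody N k₁ outBit) (k := Reg.stk k₁)
      (R := ioStore k₁ (blocks []) tmp) (by simp [blocks])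
  | a :: L, hL, tmp => by
    have ha : a ≤ N := hL a (by simp)
    have hL' : ∀ b ∈ L, b ≤ N := fun b hb => hL b (by simp [hb])
    cases a with
    | zero =>
      have ih := runs_postLoop k₁ outBit L hL' (outBit 0 :: tmp)
      have h1 : Runs (postBody N k₁ outBit false) (ioStore k₁ (blocks L) tmp)
          (ioStore k₁ (blocks L) (outBit 0 :: tmp)) 1 := Runs.push' (by simp)
      have h := Runs.loop_cons (k := Reg.stk k₁) (f := postBody N k₁ outBit)
        (R := ioStore k₁ (blocks (0 :: L)) tmp) (a := false) (w := blocks L)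
        (by simp [blocks_cons]) (by simpa using h1) ih
      refine h.of_eq (by simp) ?_
      simp only [List.length_cons]; nlinarith
    | succ j =>
      have ih := runs_postLoop k₁ outBit L hL' (outBit (j + 1) :: tmp)
      have h1 : Runs (postBody N k₁ outBit true)
          (ioStore k₁ (List.replicate j true ++ false :: blocks L) tmp)
          (ioStore k₁ (blocks L) (outBit (j + 1) :: tmp)) (1 + 2 * (j + 1)) := by
        refine runs_chain_block (Reg.stk k₁) _ j 1 (N + 1) _ (blocks L) (by simp) (by omega) ?_
        exact Runs.push' (by simp)
      have h := Runs.loop_cons (k := Reg.stk k₁) (f := postBody N k₁ outBit)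
        (R := ioStore k₁ (blocks ((j + 1) :: L)) tmp) (a := true)
        (w := List.replicate j true ++ false :: blocks L)
        (by simp [blocks_cons, List.replicate_succ]) (by simpa using h1) ih
      refine h.of_eq (by simp) ?_
      simp only [List.length_cons]; nlinarith

/-- **Effect and cost of the postlude**: the blocks of `L` on `stk k₁` become the Boolean word
`L.map outBit`. [folklore] -/
theorem runs_postlude {N : ℕ} (k₁ : Fin nK) (outBit : ℕ → Bool) (L : List ℕ)
    (hL : ∀ a ∈ L, a ≤ N) :
    Runs (postlude N k₁ outBit) (ioStore k₁ (blocks L) []) (ioStore k₁ (L.map outBit) [])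
      ((2 * N + 5) * L.length + 1 + (3 * L.length + 1)) := by
  unfold postlude
  have h1 := runs_postLoop k₁ outBit L hL []
  rw [List.append_nil] at h1
  have h2 := runs_pour (Γ := Bool) (a := Reg.tmp) (b := Reg.stk k₁) (by simp)
    (ioStore k₁ [] (L.map outBit).reverse)
  simp only [ioStore_tmp, ioStore_self, List.reverse_reverse, List.append_nil,
    update_ioStore_tmp, update_ioStore_self, List.length_reverse, List.length_map] at h2
  exact h1.seq h2

/-! ### The binary program of a standard machine -/

section Flat

variable (c : TM2Std.SCode)

/-- **The binary program** of the standard machine `c` (not `FlatProg.compile` of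
`FlatPrograms.lean`, see the module docstring), for the input coding `inCode` (code numbers of
the two input symbols) and the output decoding `outBit`. [cite: AroraBarak2009, §1.4] -/
def binProg (inCode : Bool → ℕ) (outBit : ℕ → Bool) : Prog c.nK :=
  prelude c.k₀ inCode ;; pushBlock .ctrl (ctrlVal c c.main c.init) ;; mainLoop c ;;
    postlude c.N c.k₁ outBit

/-- The constant of the binary program. [folklore] -/
noncomputable def binConst : ℕ := 4 * c.N + 6 + stepCost c + c.nΛ * c.nσ + (2 * c.N + 8) + 5

/-- Mapping the entries of a one-stack assignment. [folklore] -/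
theorem map_update_bot {α β : Type} (k : Fin nK) (L : List α) (f : α → β) :
    (fun k' => (update (fun _ => ([] : List α)) k L k').map f) = update (fun _ => []) k (L.map f) := by
  funext k'
  by_cases h : k' = k
  · subst h; simp
  · simp [update_of_ne h]

/-- **The binary program simulates the standard machine**: a halting run of `n` steps from the
input `l.map inCode` to the output `L'` becomes a run of `binProg` from the Boolean word `l` on
`stk k₀` to the Boolean word `L'.map outBit` on `stk k₁`, within
`binConst · (n + |l| + |L'|) + binConst` steps. [cite: AroraBarak2009, §1.4] -/
theorem runs_binProg (inCode : Bool → Fin (c.N + 1)) (outBit : ℕ → Bool) (l : List Bool)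
    (L' : List (Fin (c.N + 1))) (n : ℕ)
    (h : (flip bind (TM2.step fun l => (c.prog l).toStmt))^[n]
      (some ⟨some c.main, c.init, update (fun _ => []) c.k₀ (l.map inCode)⟩) =
      some ⟨none, c.init, update (fun _ => []) c.k₁ L'⟩) :
    Runs (binProg c (fun b => (inCode b).val) outBit) (AStore.single (.stk c.k₀) l)
      (AStore.single (.stk c.k₁) (L'.map fun a => outBit a.val))
      (binConst c * (n + l.length + L'.length) + binConst c) := by
  unfold binProg
  have h1 := runs_prelude c.k₀ (inCode := fun b => (inCode b).val) (B := c.N)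
    (fun b => Nat.le_of_lt_succ (inCode b).isLt) l
  have h2 := runs_pushBlock Reg.ctrl (ctrlVal c c.main c.init)
    (enc (update (fun _ => []) c.k₀ (l.map fun b => (inCode b).val)) [] [])
  simp only [enc_ctrl, List.append_nil, update_enc_ctrl] at h2
  have h3 := runs_mainLoop c n _ _ h rfl
  have e3 : encCfg c ⟨some c.main, c.init, update (fun _ => []) c.k₀ (l.map inCode)⟩ =
      enc (update (fun _ => []) c.k₀ (l.map fun b => (inCode b).val))
        (block (ctrlVal c c.main c.init)) [] := by
    simp only [encCfg, encS, nextCtrl, map_update_bot, List.map_map]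
    rfl
  have e3' : encCfg c ⟨none, c.init, update (fun _ => []) c.k₁ L'⟩ =
      ioStore c.k₁ (blocks (L'.map Fin.val)) [] := by
    simp only [encCfg, encS, nextCtrl, map_update_bot, ioStore_blocks]
  rw [e3, e3'] at h3
  have h4 := runs_postlude (N := c.N) c.k₁ outBit (L'.map Fin.val)
    (fun a ha => by
      obtain ⟨x, -, rfl⟩ := List.mem_map.1 ha
      exact Nat.le_of_lt_succ x.isLt)
  simp only [List.map_map, List.length_map] at h4
  rw [single_eq_ioStore, single_eq_ioStore]
  refine (h1.seq (h2.seq (h3.seq h4))).of_eq rfl ?_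
  have hv := ctrlVal_lt c c.main c.init
  simp only [binConst]
  nlinarith

end Flat

/-! ### From Mathlib's bundled machines -/

/-- **Every `TM2` machine over `{0,1}` is a structured binary stack program with linear
overhead**: for `M : TM2ComputableAux Bool Bool` there are a number of stacks `nK`, a program
`P` over the registers `Reg nK`, input/output registers and a constant `e` such that whenever
`M` outputs `l'` on `l` within `m` steps, `P` runs from the input store (`l` on the input
register) to the output store (`l'` on the output register) within `e (m + |l| + |l'|) + e`
steps. (Standardise by `TM2Std.stdCode`, then `runs_binProg`.) [cite: AroraBarak2009, §1.3 (Claim 1.5) and §1.4] -/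
theorem exists_runs_of_outputsWithin (M : TM2ComputableAux Bool Bool) :
    ∃ (nK : ℕ) (P : Prog nK) (k₀ k₁ : Fin nK) (e : ℕ), ∀ (l l' : List Bool) (m : ℕ),
      M.OutputsWithin l l' m →
      Runs P (AStore.single (.stk k₀) l) (AStore.single (.stk k₁) l') (e * (m + l.length + l'.length) + e) := by
  classical
  set tm := M.tm
  set c := TM2Std.stdCode tm with hc
  let inCode : Bool → Fin (c.N + 1) := fun b => TM2Std.enc tm ⟨tm.k₀, M.inputAlphabet.symm b⟩
  let outBit : ℕ → Bool := fun v =>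
    if h : v < TM2Std.stdN tm + 1 then
      (TM2Std.decOpt tm tm.k₁ (some ⟨v, h⟩)).elim false M.outputAlphabet
    else false
  refine ⟨c.nK, binProg c (fun b => (inCode b).val) outBit, c.k₀, c.k₁, binConst c, ?_⟩
  intro l l' m h
  obtain ⟨hout, hall⟩ := TM2Std.outputs_tr tm h
  obtain ⟨⟨⟨n, hev⟩, hle⟩⟩ := hout
  simp only [Option.map_some] at hev
  change n ≤ m at hle
  rw [TM2Comp.initList_eq, TM2Comp.haltList_eq] at hev
  have hin : TM2Std.stkCode tm tm.k₀ (l.map M.inputAlphabet.symm) = l.map inCode := by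
    simp [TM2Std.stkCode, List.map_map, inCode]
  rw [hin] at hev
  have hR := runs_binProg c inCode outBit l (TM2Std.stkCode tm tm.k₁ (l'.map M.outputAlphabet.symm)) n hev
  have hout' : (TM2Std.stkCode tm tm.k₁ (l'.map M.outputAlphabet.symm)).map
      (fun a => outBit a.val) = l' := by
    simp only [TM2Std.stkCode, List.map_map]
    conv_rhs => rw [← List.map_id l']
    refine List.map_congr_left fun b hb => ?_
    have hγ : (⟨tm.k₁, M.outputAlphabet.symm b⟩ : Σ k, tm.Γ k) ∈ TM2Std.allowed tm :=
      hall _ (List.mem_map.2 ⟨b, hb, rfl⟩)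
    simp only [Function.comp_apply, outBit, dif_pos (Fin.isLt _), Fin.eta,
      TM2Std.decOpt_enc tm hγ, Option.elim_some, Equiv.apply_symm_apply, id_eq]
  rw [hout'] at hR
  refine hR.mono ?_
  have hlen : (TM2Std.stkCode tm tm.k₁ (l'.map M.outputAlphabet.symm)).length = l'.length := by
    simp [TM2Std.stkCode]
  rw [hlen]
  have := binConst c
  nlinarith

/-- **Flat form**: the compiled program (`AProg Bool (Reg nK)`: `push`/`pop`/`goto`) runs from
`⟨0, input store⟩` to the halted address `|P|` with the output store, within
`e (m + |l| + |l'|) + e` steps. [cite: AroraBarak2009, §1.3 (Claim 1.5) and §1.4] -/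
theorem exists_aprog_of_outputsWithin (M : TM2ComputableAux Bool Bool) :
    ∃ (nK : ℕ) (P : AProg Bool (Reg nK)) (k₀ k₁ : Fin nK) (e : ℕ), ∀ (l l' : List Bool) (m : ℕ),
      M.OutputsWithin l l' m → ∃ t ≤ e * (m + l.length + l'.length) + e,
        P.step^[t] ⟨0, AStore.single (.stk k₀) l⟩ = ⟨P.length, AStore.single (.stk k₁) l'⟩ := by
  classical
  obtain ⟨nK, P, k₀, k₁, e, hP⟩ := exists_runs_of_outputsWithin M
  refine ⟨nK, P.compile, k₀, k₁, e, fun l l' m h => ?_⟩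
  obtain ⟨t, ht, hex⟩ := hP l l' m h
  exact ⟨t, ht, by rw [length_compile]; exact hex.compile_iterate⟩

/-! ### Numbered registers -/

/-- Numbering the registers: stack `k` ↦ `k`, control ↦ `nK`, scratch ↦ `nK + 1`. [folklore] -/
def regNum (nK : ℕ) : Reg nK → Fin (nK + 2)
  | .stk k => k.castAdd 2
  | .ctrl => ⟨nK, by omega⟩
  | .tmp => ⟨nK + 1, by omega⟩

/-- The numbering is injective. [folklore] -/
theorem regNum_injective (nK : ℕ) : Injective (regNum nK) := by
  intro a b h
  cases a with
  | stk k =>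
    cases b with
    | stk k' => simp only [regNum, Fin.castAdd_inj] at h; rw [h]
    | ctrl => simp only [regNum, Fin.ext_iff, Fin.val_castAdd] at h; have := k.isLt; omega
    | tmp => simp only [regNum, Fin.ext_iff, Fin.val_castAdd] at h; have := k.isLt; omega
  | ctrl =>
    cases b with
    | stk k' => simp only [regNum, Fin.ext_iff, Fin.val_castAdd] at h; have := k'.isLt; omega
    | ctrl => rfl
    | tmp => simp only [regNum, Fin.ext_iff] at h; omega
  | tmp =>
    cases b with
    | stk k' => simp only [regNum, Fin.ext_iff, Fin.val_castAdd] at h; have := k'.isLt; omega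
    | ctrl => simp only [regNum, Fin.ext_iff] at h; omega
    | tmp => rfl

/-- Renaming an input/output store along an injective map. [folklore] -/
theorem single_comp_apply {ι κ : Type} [DecidableEq ι] [DecidableEq κ] {f : ι → κ}
    (hf : Injective f) (k : ι) (w : List Bool) (i : ι) :
    AStore.single (f k) w (f i) = AStore.single k w i := by
  simp [AStore.single, hf.eq_iff]

/-- Grafting an output store into an input store along an injective map. [folklore] -/
theorem graft_single {ι κ : Type} [DecidableEq ι] [DecidableEq κ] {f : ι → κ}
    (hf : Injective f) (k₀ k₁ : ι) (l l' : List Bool) :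
    graft (AStore.single (f k₀) l) f (AStore.single k₁ l') = AStore.single (f k₁) l' := by
  funext x
  by_cases hx : ∃ i, f i = x
  · obtain ⟨i, rfl⟩ := hx
    rw [graft_apply _ hf, single_comp_apply hf]
  · have hk : ∀ i, f i ≠ x := fun i hi => hx ⟨i, hi⟩
    rw [graft_of_not _ _ _ hk, AStore.single_of_ne (hk k₀).symm, AStore.single_of_ne (hk k₁).symm]

/-- **Flat form with numbered registers**: a flat binary program over the registers
`Fin K` runs from `⟨0, input on inp⟩` to `⟨|P|, output on out⟩` within `e (m + |l| + |l'|) + e`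
steps whenever `M` outputs `l'` on `l` within `m` steps — the normal form interpreted by the
universal machine. [cite: AroraBarak2009, §1.3 (Claim 1.5) and §1.4] -/
theorem exists_aprogFin_of_outputsWithin (M : TM2ComputableAux Bool Bool) :
    ∃ (K : ℕ) (P : AProg Bool (Fin K)) (inp out : Fin K) (e : ℕ), ∀ (l l' : List Bool) (m : ℕ),
      M.OutputsWithin l l' m → ∃ t ≤ e * (m + l.length + l'.length) + e,
        P.step^[t] ⟨0, AStore.single inp l⟩ = ⟨P.length, AStore.single out l'⟩ := by
  classical
  obtain ⟨nK, P, k₀, k₁, e, hP⟩ := exists_runs_of_outputsWithin M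
  refine ⟨nK + 2, (P.map (regNum nK)).compile, regNum nK (.stk k₀), regNum nK (.stk k₁), e,
    fun l l' m h => ?_⟩
  have hR := (hP l l' m h).map (regNum_injective nK) (AStore.single (regNum nK (.stk k₀)) l)
    (fun i => single_comp_apply (regNum_injective nK) _ _ i)
  rw [graft_single (regNum_injective nK)] at hR
  obtain ⟨t, ht, hex⟩ := hR
  exact ⟨t, ht, by rw [length_compile]; exact hex.compile_iterate⟩

end TM2Flat

end Literature.Computability.Complexity
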